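import Literature.AlgebraicGeometry.Resolution.MuPTorsorLocalUniformizationAllFields
import Summits.ResolutionOfSingularities.ResolutionOfSingularities.Theorems.SoloInformedFFinite
import HarnessLib

/-!
# Solo (informed): the `μ_p`-torsor face of the summit over an arbitrary ground field

Session-3 strengthening of `SoloInformedFFinite`: the hypothesis `FrobeniusFinite p k`
(`[k : k^p] < ∞`) is removed from the converse direction. Given Temkin's inseparable local
uniformization in its relative smooth form (`Temkin2013Relative`, a named Literature fact),
uniformization of `μ_p`-torsor steps over the ground field `k` itself
(`∀ K O, MuPTorsorStepsAt p k O`) implies local uniformization of every valuation of every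
finitely generated `K/k` (`isLocallyUniformizable_of_muPTorsorStepsAt_of_relative`, via the
Frobenius-twisted smooth model `k ⊗_l N_g`), hence — with Zariski two-model patching — a
resolution of every reduced separated `k`-variety, for ANY field `k` of characteristic `p`.

Together with `muPTorsorLocalUniformizationInChar_of_resolutionInChar` (summit ⇒ torsor
uniformization, unconditional) this makes `MuPTorsorLocalUniformizationInChar p` an exact
local proxy of `ResolutionInChar p` modulo the two classical inputs (Temkin; patching), with no
restriction on the ground field.
-/

noncomputable section

namespace Summit.ResolutionOfSingularities.ResolutionOfSingularities.Theorems

open CategoryTheory AlgebraicGeometry IsLocalRing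
open Literature.AlgebraicGeometry Literature.AlgebraicGeometry.Resolution

universe u

/-- **Torsor steps over `k` + Temkin (relative) + patching ⇒ resolution over `k`**, for an
arbitrary field `k` of characteristic `p`. -/
theorem hasResolution_of_muPTorsorStepsAt_of_projPatching {p : ℕ} [Fact p.Prime]
    (hT : Temkin2013Relative.{u}) {k : Type u} [Field k] [CharP k p]
    (H : ∀ (K : Type u) [Field K] [Algebra k K] (O : ValuationSubring K),
      MuPTorsorStepsAt p k O)
    (hZ : ∀ (K : Type u) [Field K] [Algebra k K] [Algebra.EssFiniteType k K],
      ∀ M₁ M₂ : ProjModel k K,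
        ∃ (N : ProjModel k K) (φ₁ : N.Hom M₁) (φ₂ : N.Hom M₂), φ₁.RegLe ∧ φ₂.RegLe)
    (X : Scheme.{u}) (f : X ⟶ Spec (.of k)) (hs : IsSeparated f) (hl : LocallyOfFiniteType f)
    (hq : QuasiCompact f) (hr : IsReduced X) : Scheme.HasResolution X := by
  haveI : QuasiCompact f := hq
  haveI : LocallyOfFiniteType f := hl
  haveI : CompactSpace X := QuasiCompact.compactSpace_of_compactSpace f
  obtain ⟨d, hd⟩ := exists_topologicalKrullDim_le_of_locallyOfFiniteType f
  have hU : ∀ (K : Type u) [Field K] [Algebra k K] (A₀ : Subalgebra k K), A₀.FG →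
      IsFractionRing A₀ K → ∀ v : ZariskiRiemannSpace k K, ∃ T : Subalgebra k K,
        (T.FG ∧ IsFractionRing T K) ∧ ZariskiRiemannSpace.HasRegularCentre T v := by
    intro K _ _ A₀ hA₀fg hA₀fr v
    haveI : Algebra.FiniteType k A₀ := A₀.fg_iff_finiteType.mp hA₀fg
    haveI : Algebra.EssFiniteType A₀ K :=
      Algebra.EssFiniteType.of_isLocalization K (nonZeroDivisors A₀)
    have hKfg : (⊤ : IntermediateField k K).FG :=
      IntermediateField.fg_top_iff.mpr (Algebra.EssFiniteType.comp k A₀ K)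
    exact exists_hasRegularCentre_of_lu
      (fun O hO => isLocallyUniformizable_of_muPTorsorStepsAt_of_relative hT hKfg O hO (H K O))
      v
  refine ResolutionOverUpToDim.of_projective (k := k) (d := d) (fun _ Y ι hι hint _ => ?_)
    X f hs hl hq hr hd
  haveI := hι
  haveI := hint
  exact hasResolution_of_twoModelPatching_of_uniformizable hZ hU Y ι

/-- The same, packaged as `ResolutionOverUpToDim k d` for every `d`. -/
theorem resolutionOverUpToDim_of_muPTorsorStepsAt_of_projPatching {p : ℕ} [Fact p.Prime]
    (hT : Temkin2013Relative.{u}) {k : Type u} [Field k] [CharP k p]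
    (H : ∀ (K : Type u) [Field K] [Algebra k K] (O : ValuationSubring K),
      MuPTorsorStepsAt p k O)
    (hZ : ∀ (K : Type u) [Field K] [Algebra k K] [Algebra.EssFiniteType k K],
      ∀ M₁ M₂ : ProjModel k K,
        ∃ (N : ProjModel k K) (φ₁ : N.Hom M₁) (φ₂ : N.Hom M₂), φ₁.RegLe ∧ φ₂.RegLe)
    (d : ℕ) : ResolutionOverUpToDim k d :=
  fun X f hs hl hq hr _ => hasResolution_of_muPTorsorStepsAt_of_projPatching hT H hZ X f hs hl hq hr

/-- **The torsor problem in characteristic `p` suffices over every ground field** (with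
Temkin's relative theorem and patching): no `[k : k^p] < ∞` hypothesis, in contrast to
`resolutionOverUpToDim_of_muPTorsorInChar_of_projPatching`. -/
theorem resolutionOverUpToDim_of_muPTorsorInChar_of_projPatching_allFields {p : ℕ}
    [Fact p.Prime] (hT : Temkin2013Relative.{u}) (H : MuPTorsorLocalUniformizationInChar.{u} p)
    {k : Type u} [Field k] [CharP k p]
    (hZ : ∀ (K : Type u) [Field K] [Algebra k K] [Algebra.EssFiniteType k K],
      ∀ M₁ M₂ : ProjModel k K,
        ∃ (N : ProjModel k K) (φ₁ : N.Hom M₁) (φ₂ : N.Hom M₂), φ₁.RegLe ∧ φ₂.RegLe)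
    (d : ℕ) : ResolutionOverUpToDim k d :=
  resolutionOverUpToDim_of_muPTorsorStepsAt_of_projPatching hT (fun K _ _ O => H k K O) hZ d

/-- **Exact local proxy.** Given Temkin's relative theorem, resolution in characteristic `p`
implies, and local uniformization in characteristic `p` is equivalent to, uniformization of
`μ_p`-torsor steps over every ground field of characteristic `p`. -/
theorem resolutionInChar_localProxy {p : ℕ} [Fact p.Prime] (hT : Temkin2013Relative.{u}) :
    (ResolutionInChar.{u} p → MuPTorsorLocalUniformizationInChar.{u} p) ∧
      (LocalUniformizationInChar.{u} p ↔ MuPTorsorLocalUniformizationInChar.{u} p) :=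
  ⟨muPTorsorLocalUniformizationInChar_of_resolutionInChar,
    localUniformizationInChar_iff_muPTorsorInChar hT⟩

end Summit.ResolutionOfSingularities.ResolutionOfSingularities.Theorems

end
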